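import Mathlib.MeasureTheory.Measure.Lebesgue.Complex
import Mathlib.MeasureTheory.Integral.IntervalIntegral.Basic
import Mathlib.Data.Int.GCD
import Literature.Analysis.DeBrangesSpaces.Basic
import Literature.NumberTheory.LFunctions.DirichletLThetaRepresentation
import HarnessLib

/-!
# de Branges 1986, Theorems 1–5: the character spaces `𝒫_χ(r)`, the scattering operator `W_χ`,
# and the de Branges spaces `𝓗(E_χ(a))` of a Dirichlet `L`-function (statements as printed)

LABEL (line 1): **RH-FREE** — typed statements of PRINTED, PROVED theorems of
L. de Branges, *The Riemann hypothesis for Hilbert spaces of entire functions*, Bull. Amer. Math.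
Soc. (N.S.) **15** (1986) 1–17 [deBranges1986], sections "Character zeta-functions" to "Spectral
theory", pp. 3–14 (held copy `paper:url-012807b01c95`, page images read; the OCR text layer is
unusable for formulas, every formula below was read off the rendered page image). bears_on:
LADDER-RH COLUMN 6 (DBR), rungs B-C/B-P. WHAT THIS IS NOT: not a route, not a positivity condition
at `E_ζ` (Conrey–Li GUARD: no clause below asserts any de Branges positivity hypothesis; the one
structure-function claim, `deBranges1986_isHermiteBiehler_EChar`, is the Dirichlet analogue of the
UNCONDITIONAL Lagarias Lemma 2.1 (1) at `h = 1/2`, `Literature.NumberTheory.LFunctions.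
lagarias2005_lemma_2_1`), and nothing here bears on the truth of RH. Typing a printed theorem is
transcription, not progress toward RH.

## The printed objects (pp. 3–12) and their Lean names (namespace `…DeBrangesSpaces.DeBranges1986`)

* `ζ_χ(s) = Σ χ(n) n^{-s}` (p. 3 l. 40 – p. 4 l. 5) is Mathlib's `DirichletCharacter.LFunction χ`
  (the analytic continuation; de Branges uses `ζ_χ(1 − iz)` on all of `ℂ`). `χ̄` is `χ⁻¹`
  (`MulChar.star_apply'`). "nonprincipal" is `χ ≠ 1`, "primitive" is `χ.IsPrimitive`, "even" is
  `χ.Even`, "`r` not one" is `r ≠ 1`; `χ(D)` for an integer `D` is `χ (D : ZMod r)`.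
* `ε(χ)`, `|ε(χ)| = 1`, `ε(χ) χ̄(n) = r^{-1/2} Σ_{k=1}^{r} χ(k) cos(2πnk/r)` (p. 4 l. 6–9) is, for
  an even primitive `χ`, Mathlib's `DirichletCharacter.rootNumber χ = gaussSum χ e / r^{1/2}`; the
  printed functional identity `(r/π)^{s/2} Γ(s/2) ζ_χ(s) = ε(χ) (r/π)^{(1−s)/2} Γ(½ − ½s) ζ_χ̄(1 − s)`
  (p. 4 l. 17–18) is the tree's `DirichletTheta.dirichletXi_eq_rootNumber_mul_dirichletXi_inv_one_sub`
  — so both dictionaries are pinned by a tree theorem, not by this file.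
* `(r/π)^{s/2} Γ(s/2) ζ_χ(s)` (even `χ`) is EXACTLY the tree's Montgomery–Vaughan
  `Literature.NumberTheory.LFunctions.DirichletTheta.dirichletXi χ s = r^{s/2} Λ(s, χ)` (parity
  `κ = 0`; `dirichletXi_eq_LFunction_mul` recovers the printed product wherever `Γ(s/2)` is finite).
  We write the printed products through `dirichletXi` (tree vocabulary; `EChar_eq_printed` below).
* `θ_χ(z) = Σ_{n ∈ ℤ} χ(n) exp(πin²z/r)` (p. 4 l. 9–12): `charTheta` (at `z = iy` it is the tree's
  `DirichletTheta.dirichletTheta 0 χ y`, `charTheta_mul_I`).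
* `Γ(r)` (p. 4 l. 38–40) = the maps `z ↦ (Az+B)/(Cz+D)`, `A B C D ∈ ℤ`, `r ∣ C`, `AD − BC = 1`
  (the Hecke congruence subgroup `Γ₀(r)`): `moebius`, `IsHeckeEquivalent`; fundamental region
  (p. 5 l. 19–22 for `Γ(r)*`, "similar" for `Γ(r)` p. 6 l. 6–7): `IsFundamentalRegion`.
* `𝒫_χ(r)`, `𝒫(∞)` and their norms (p. 6 l. 21–33): `MemPChar χ Ω`, `pCharNormSq Ω`,
  `MemPInfty`, `pInftyNormSq`. The summation transformation `F ↦ ½ Σ χ(D) F((Az+B)/(Cz+D))`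
  over coprime `(C, D)` with `r ∣ C` (Theorem 1, p. 7 l. 5–9): `cosetPairs`, `summand`,
  `summation` (the integers `A, B` are fixed by Bézout, `summand_det`; for `F ∈ 𝒫(∞)` the choice is
  immaterial, `moebius_add_mul`).
* `k_χ(t)` (Theorem 3, p. 10 l. 38 – p. 11 l. 2): `kChar`; `W_χ(z) = r^{-1/2} ∫₁^∞ k_χ(t)
  t^{(iz−1)/2} dt` (Theorem 4, p. 11 l. 22–24): `WChar`; `E_χ(a, z) = a^{−iz/2} (r/π)^{(1−iz)/2}
  Γ((1−iz)/2) ζ_χ(1−iz)` for `a ≥ 1` (p. 12 l. 25–26): `EChar χ a`.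
* `𝓗(E)` (p. 3 l. 11–25) is de Branges' own definition: entire `F` with `∫ |F(t)/E(t)|² dt < ∞`
  and `|F(z)|² ≤ ‖F‖² K(z, z)` for all `z` — the tree's `Differentiable ℂ F ∧ Integrable ‖F/E‖² ∧
  HasKernelBound E F` (exactly as in `conreyLi2000_thm1`; NOT `DeBrangesSpace E`), norm
  `deBrangesNormSq E F`.

## Lean rendering of the Hilbert-space statements (read this before using the facts)

de Branges states Theorems 1–3 and 5 for ISOMETRIES defined on a dense class and "otherwise
defined by continuity in the Hilbert space norms" (p. 7 l. 14–19), with Mellin integrals and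
`∫₁^∞` "interpreted as a limit in the mean square sense" (p. 11 l. 8; p. 12 l. 12). The named facts
below render each theorem ON THE PRINTED DENSE CLASS `∫₀^∞ |F(iy)| y⁻² dy < ∞` (where the sums
converge absolutely a.e., p. 7 l. 14–18) and with EXPLICIT integrability binders on every Mellin
integral; mean-square limits are written as `Tendsto … (𝓝 0)` of the squared `𝒫(∞)`-distance.
Each fact is therefore the printed theorem restricted to a sub-class (never stronger than print);
the continuity extensions and the surjectivity clause of Theorem 5 ("every element of `𝓗(E_χ̄(a))`
is such an `H`") are NOT restated — `TODO(general form)` marks them. The scattering relation of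
Theorems 2, 3, 5 ("`F, G ∈ 𝒫(∞)` such that `½ Σ χ̄(D) G((Az+B)/(Cz+D)) = ½ Σ χ(D) F((A−Brz)/(C−Drz))`")
is `IsScatteringPair χ F G` (both sums absolutely convergent a.e. and equal a.e. on the upper
half-plane — explicit `Summable` binders; note `(A−Brz)/(C−Drz)` is the image of `−1/(rz)`).

Theorem 6/7 (positivity) and the closing conjecture (pp. 14–17) are NOT here (typer t1:
`DeBranges1986Positivity.lean`; the Conrey–Li form is `conreyLi2000_thm1`, PROVED); the
Laplace–Beltrami operator `G = (z − z̄)² ∂²F/∂z∂z̄` (p. 6 l. 16–17) is only motivation in print and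
is not typed.

## References

* [deBranges1986] L. de Branges, Bull. AMS (N.S.) 15 (1986) 1–17,
  doi:10.1090/S0273-0979-1986-15429-7, Theorems 1–5 (pp. 7–13, read from the page images).
* [ConreyLi2000] J. B. Conrey, X.-J. Li, IMRN 2000:18 — `𝓗(E)` membership (2.1) as used here.
* [MontgomeryVaughan2007] §10.1 — `ξ(s, χ)`, `ε(χ)` (tree files `DirichletLThetaRepresentation`,
  `DirichletThetaTransformation`).
-/

noncomputable section

open scoped ComplexConjugate Real Topology
open _root_.Complex _root_.MeasureTheory _root_.Set _root_.Filter
open Literature.NumberTheory.LFunctions (charParity charParity_of_even)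
open Literature.NumberTheory.LFunctions.DirichletTheta (dirichletXi dirichletTheta thetaTerm
  dirichletXi_eq_LFunction_mul)

namespace Literature.Analysis.DeBrangesSpaces

namespace DeBranges1986

variable {r : ℕ}

/-! ## Hecke subgroups, fundamental regions (pp. 4–6) -/

/-- RH-FREE (definition). The Möbius map `z ↦ (Az + B)/(Cz + D)` of an integer matrix, as de
Branges writes the action of `Γ(r)` (p. 4 l. 38–40). Junk value at the pole (`x / 0 = 0`).
[cite: deBranges1986, p. 4] -/
def moebius (A B C D : ℤ) (z : ℂ) : ℂ := ((A : ℂ) * z + B) / ((C : ℂ) * z + D)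

/-- Unfolding `moebius`. [cite: deBranges1986, p. 4] -/
theorem moebius_def (A B C D : ℤ) (z : ℂ) :
    moebius A B C D z = ((A : ℂ) * z + B) / ((C : ℂ) * z + D) := rfl

/-- Changing the "corresponding integers `A, B`" by a multiple of `(C, D)` translates the image by an
integer: `((A+kC)z + (B+kD))/(Cz+D) = (Az+B)/(Cz+D) + k` (off the pole). This is why de Branges'
sums over `(C, D)` only are well defined on translation-invariant `F` ("`A` and `B` being corresponding
integers such that `AD − BC = 1`", p. 7 l. 8–9). [cite: deBranges1986, Theorem 1, p. 7 l. 8–9] -/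
theorem moebius_add_mul (A B C D k : ℤ) {z : ℂ} (hz : (C : ℂ) * z + D ≠ 0) :
    moebius (A + k * C) (B + k * D) C D z = moebius A B C D z + k := by
  unfold moebius
  push_cast
  field_simp
  ring

/-- RH-FREE (definition). `Γ(r)`-equivalence of points (p. 4 l. 38 – p. 5 l. 8): `w` is obtained
from `z` under a map `z ↦ (Az+B)/(Cz+D)` with integers `A, B, C, D`, `C` divisible by `r`,
`AD − BC = 1` (de Branges' `Γ(r)` is the Hecke congruence subgroup usually written `Γ₀(r)`).
[cite: deBranges1986, pp. 4–5] -/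
def IsHeckeEquivalent (r : ℕ) (z w : ℂ) : Prop :=
  ∃ A B C D : ℤ, (r : ℤ) ∣ C ∧ A * D - B * C = 1 ∧ w = moebius A B C D z

/-- RH-FREE (definition). A **fundamental region** `Ω` for `Γ(r)`, with the three printed clauses
(p. 5 l. 19–22, stated for `Γ(r)*` and carried over to `Γ(r)` "by a similar piecing together",
p. 6 l. 6–7): a connected open subset of the upper half-plane which contains no two distinct
`Γ(r)`-equivalent points, such that the points of the upper half-plane equivalent to no element of
`Ω` form a set of zero plane (Lebesgue) measure. [cite: deBranges1986, p. 5 l. 19–22] -/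
def IsFundamentalRegion (r : ℕ) (Ω : Set ℂ) : Prop :=
  IsOpen Ω ∧ IsConnected Ω ∧ Ω ⊆ {z : ℂ | 0 < z.im} ∧
    (∀ z ∈ Ω, ∀ w ∈ Ω, IsHeckeEquivalent r z w → z = w) ∧
    volume {z : ℂ | 0 < z.im ∧ ∀ w ∈ Ω, ¬ IsHeckeEquivalent r w z} = 0

/-! ## The spaces `𝒫_χ(r)` and `𝒫(∞)` (p. 6) -/

/-- RH-FREE (definition). Membership in de Branges' **`𝒫_χ(r)`** (p. 6 l. 21–28), relative to a
fundamental region `Ω` for `Γ(r)`: a measurable `F` on the upper half-plane with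
`F(z) = χ(D) F((Az+B)/(Cz+D))` for all integers `A, B, C, D` with `r ∣ C`, `AD − BC = 1`, and
`‖F‖²_{𝒫_χ(r)} = ∬_Ω |F(z)|² y⁻² dx dy < ∞` ("the integral does not depend on the choice of
fundamental region"). `F` is a function on `ℂ`; only its values on `Im z > 0` matter.
[cite: deBranges1986, p. 6 l. 21–28] -/
def MemPChar (χ : DirichletCharacter ℂ r) (Ω : Set ℂ) (F : ℂ → ℂ) : Prop :=
  Measurable F ∧
    (∀ A B C D : ℤ, (r : ℤ) ∣ C → A * D - B * C = 1 → ∀ z : ℂ, 0 < z.im →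
      F z = χ (D : ZMod r) * F (moebius A B C D z)) ∧
    IntegrableOn (fun z : ℂ => ‖F z‖ ^ 2 / z.im ^ 2) Ω

/-- RH-FREE (definition). `‖F‖²_{𝒫_χ(r)} = ∬_Ω |F(z)|² y⁻² dx dy` (p. 6 l. 26; Bochner integral for
plane Lebesgue measure on `ℂ`, junk `0` if not integrable). [cite: deBranges1986, p. 6 l. 26] -/
def pCharNormSq (Ω : Set ℂ) (F : ℂ → ℂ) : ℝ :=
  ∫ z in Ω, ‖F z‖ ^ 2 / z.im ^ 2

/-- RH-FREE (definition). Membership in de Branges' **`𝒫(∞)`** (p. 6 l. 29–33): a measurable `F`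
on the upper half-plane with `F(z − t) = F(z)` for all real `t` and
`‖F‖²_{𝒫(∞)} = ∫₀^∞ |F(iy)|² y⁻² dy < ∞`. [cite: deBranges1986, p. 6 l. 29–33] -/
def MemPInfty (F : ℂ → ℂ) : Prop :=
  Measurable F ∧ (∀ z : ℂ, 0 < z.im → ∀ t : ℝ, F (z - t) = F z) ∧
    IntegrableOn (fun y : ℝ => ‖F (y * I)‖ ^ 2 / y ^ 2) (Ioi 0)

/-- RH-FREE (definition). `‖F‖²_{𝒫(∞)} = ∫₀^∞ |F(iy)|² y⁻² dy` (p. 6 l. 32; junk `0` if not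
integrable). [cite: deBranges1986, p. 6 l. 32] -/
def pInftyNormSq (F : ℂ → ℂ) : ℝ :=
  ∫ y in Ioi (0 : ℝ), ‖F (y * I)‖ ^ 2 / y ^ 2

/-! ## The summation transformation (Theorem 1, p. 7) -/

/-- RH-FREE (definition). The index set of de Branges' sums: "all pairs of relatively prime
integers `C` and `D` such that `C` is divisible by `r`" (p. 7 l. 8–9). [cite: deBranges1986, p. 7] -/
def cosetPairs (r : ℕ) : Set (ℤ × ℤ) :=
  {p | IsCoprime p.1 p.2 ∧ (r : ℤ) ∣ p.1}

/-- RH-FREE (definition). The summand `χ(D) F((Az+B)/(Cz+D))` of Theorem 1 (p. 7 l. 7), "`A` and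
`B` being corresponding integers such that `AD − BC = 1`": we FIX them by Bézout,
`A = Int.gcdB C D`, `B = −Int.gcdA C D` (`summand_det`); for translation-invariant `F` (elements of
`𝒫(∞)`) any other choice gives the same value (`moebius_add_mul`). [cite: deBranges1986, p. 7 l. 5–9] -/
def summand (χ : DirichletCharacter ℂ r) (F : ℂ → ℂ) (z : ℂ) (p : ℤ × ℤ) : ℂ :=
  χ (p.2 : ZMod r) * F (moebius (Int.gcdB p.1 p.2) (-Int.gcdA p.1 p.2) p.1 p.2 z)

/-- The Bézout choice in `summand` has determinant one: `A D − B C = 1` for coprime `(C, D)` — the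
printed side condition of Theorem 1 (p. 7 l. 8–9). [cite: deBranges1986, Theorem 1, p. 7 l. 8–9] -/
theorem summand_det {C D : ℤ} (h : IsCoprime C D) :
    Int.gcdB C D * D - (-Int.gcdA C D) * C = 1 := by
  have hg : Int.gcd C D = 1 := Int.isCoprime_iff_gcd_eq_one.mp h
  have hab := Int.gcd_eq_gcd_ab C D
  rw [hg] at hab
  push_cast at hab
  linear_combination -hab

/-- RH-FREE (definition). de Branges' **summation transformation** (Theorem 1, p. 7 l. 5–9):
`F ↦ ½ Σ χ(D) F((Az+B)/(Cz+D))`, the sum over `cosetPairs r` (unconditional = absolute sum in `ℂ`;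
junk `0` where the family is not summable — by Theorem 1 it is summable a.e. on the printed dense
class). The factor `½` accounts for `(C, D)` and `(−C, −D)` giving the same map.
[cite: deBranges1986, Theorem 1, p. 7 l. 5–9] -/
def summation (χ : DirichletCharacter ℂ r) (F : ℂ → ℂ) (z : ℂ) : ℂ :=
  (1 / 2) * ∑' p : cosetPairs r, summand χ F z (p : ℤ × ℤ)

/-! ## Theta function, `k_χ`, `W_χ`, `E_χ(a, z)` (pp. 4, 10–12) -/

/-- RH-FREE (definition). The theta function of a character, `θ_χ(z) = Σ_{n ∈ ℤ} χ(n) exp(πin²z/r)`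
on the upper half-plane (p. 4 l. 9–12); at `z = iy` it is the tree's `dirichletTheta 0 χ y`
(`charTheta_mul_I`). Used in print only for the dense family of examples in the proof of
Theorem 2 (p. 9 l. 33 – p. 10 l. 5). [cite: deBranges1986, p. 4 l. 9–12] -/
def charTheta (χ : DirichletCharacter ℂ r) (z : ℂ) : ℂ :=
  ∑' n : ℤ, χ (n : ZMod r) * cexp (π * I * (n : ℂ) ^ 2 * z / r)

/-- RH-FREE (definition). **`k_χ(t) = Σ φ(n) χ(n) n⁻¹ (t − n²)^{-1/2}`**, the sum over the positive
integers `n` with `n² < t`, `φ` Euler's totient (Theorem 3, p. 10 l. 35 – p. 11 l. 2; defined for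
`t > 0`). [cite: deBranges1986, Theorem 3, p. 10] -/
def kChar (χ : DirichletCharacter ℂ r) (t : ℝ) : ℂ :=
  ∑ n ∈ (Finset.range (⌊t⌋₊ + 1)).filter (fun n : ℕ => 0 < n ∧ ((n : ℕ) : ℝ) ^ 2 < t),
    (Nat.totient n : ℂ) * χ ((n : ℕ) : ZMod r) / ((n : ℕ) : ℂ) /
      (Real.sqrt (t - ((n : ℕ) : ℝ) ^ 2) : ℂ)

/-- RH-FREE (definition). **`W_χ(z) = r^{-1/2} ∫₁^∞ k_χ(t) t^{(iz−1)/2} dt`** (Theorem 4, p. 11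
l. 22–24; Bochner integral on `(1, ∞)`, junk `0` where not integrable — the facts below carry the
integrability binder; in print the integral is a mean-square Mellin transform extended analytically
to the upper half-plane, p. 12 l. 12–21). [cite: deBranges1986, Theorem 4, p. 11] -/
def WChar (χ : DirichletCharacter ℂ r) (z : ℂ) : ℂ :=
  (r : ℂ) ^ (-(1 / 2 : ℂ)) * ∫ t in Ioi (1 : ℝ), kChar χ t * (t : ℂ) ^ ((I * z - 1) / 2)

/-- RH-FREE (definition). **de Branges' structure function of a character,
`E_χ(a, z) = a^{−iz/2} (r/π)^{(1−iz)/2} Γ((1−iz)/2) ζ_χ(1−iz)`** ("when `a ≥ 1`, define", p. 12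
l. 25–26), typed through the tree's entire `ξ(s, χ)`: `E_χ(a, z) = a^{−iz/2} ξ(1 − iz, χ)`
(`EChar_eq_printed` recovers the printed product off the poles of `Γ`; for a principal or odd `χ`
the value is junk relative to the paper, which assumes `χ` primitive even, `r ≠ 1`). With `a = 1`
this is `ξ(1 − iz, χ)`, the Dirichlet analogue of Conrey–Li's `E(z) = ξ(1 − iz)`.
[cite: deBranges1986, p. 12 l. 25–26] -/
def EChar [NeZero r] (χ : DirichletCharacter ℂ r) (a : ℝ) (z : ℂ) : ℂ :=
  (a : ℂ) ^ (-(I * z) / 2) * dirichletXi χ (1 - I * z)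

/-- `E_χ(1, z) = ξ(1 − iz, χ)`. [cite: deBranges1986, p. 12 l. 25–26] -/
theorem EChar_one [NeZero r] (χ : DirichletCharacter ℂ r) (z : ℂ) :
    EChar χ 1 z = dirichletXi χ (1 - I * z) := by
  simp [EChar]

/-- **The printed formula for `E_χ(a, z)`** (p. 12 l. 25–26): for an even nonprincipal `χ`, off the
poles of `Γ((1−iz)/2)` (i.e. `1 − iz ∉ {0, −2, −4, …}`, where the printed product has a removable
singularity), `E_χ(a, z) = a^{−iz/2} · (r/π)^{(1−iz)/2} Γ((1−iz)/2) ζ_χ(1−iz)`.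
[cite: deBranges1986, p. 12 l. 25–26] -/
theorem EChar_eq_printed [NeZero r] {χ : DirichletCharacter ℂ r} (hχ : χ ≠ 1) (heven : χ.Even)
    (a : ℝ) {z : ℂ} (hz : ∀ n : ℕ, 1 - I * z ≠ -(2 * (n : ℂ))) :
    EChar χ a z = (a : ℂ) ^ (-(I * z) / 2) *
      (χ.LFunction (1 - I * z) * Complex.Gamma ((1 - I * z) / 2) *
        ((r : ℂ) / π) ^ ((1 - I * z) / 2)) := by
  have hs : ∀ n : ℕ, (1 - I * z) + (charParity χ : ℂ) ≠ -(2 * (n : ℂ)) := by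
    intro n
    rw [charParity_of_even heven, Nat.cast_zero, add_zero]
    exact hz n
  rw [EChar, dirichletXi_eq_LFunction_mul hχ hs, charParity_of_even heven, Nat.cast_zero, add_zero]

/-- **`θ_χ(iy) = ϑ₀(y, χ)`**: de Branges' theta function on the imaginary axis is the tree's
(Montgomery–Vaughan) theta series. [cite: deBranges1986, p. 4 l. 9–12] -/
theorem charTheta_mul_I [NeZero r] (χ : DirichletCharacter ℂ r) (y : ℝ) :
    charTheta χ (y * I) = dirichletTheta 0 χ y := by
  unfold charTheta dirichletTheta thetaTerm
  refine tsum_congr fun n => ?_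
  have hI : I * I = -1 := I_mul_I
  have h : (π : ℂ) * I * (n : ℂ) ^ 2 * ((y : ℂ) * I) / (r : ℂ) =
      ((-(π * (n : ℝ) ^ 2 * y / r) : ℝ) : ℂ) := by
    push_cast
    calc (π : ℂ) * I * (n : ℂ) ^ 2 * ((y : ℂ) * I) / (r : ℂ)
        = (I * I) * ((π : ℂ) * (n : ℂ) ^ 2 * (y : ℂ) / (r : ℂ)) := by ring
      _ = -((π : ℂ) * (n : ℂ) ^ 2 * (y : ℂ) / (r : ℂ)) := by rw [hI]; ring
  rw [pow_zero, mul_one, Complex.ofReal_exp, h]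

/-! ## The scattering relation of Theorems 2, 3, 5 -/

/-- RH-FREE (definition). **Scattering pairs**: "`F` and `G` elements of `𝒫(∞)` such that
`½ Σ χ̄(D) G((Az+B)/(Cz+D)) = ½ Σ χ(D) F((A−Brz)/(C−Drz))`" (Theorem 2 p. 9 l. 8–10, Theorem 3
p. 11 l. 2–7, Theorem 5 p. 12 l. 32 – p. 13 l. 3), i.e. `S_{χ̄} G (z) = S_χ F (−1/(rz))`, rendered on
the class where both sums converge absolutely (explicit `Summable` binders: for a.e. `z` of the
upper half-plane both families are summable and the identity holds). Lean rendering note: where the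
printed sums are only defined by continuity (Theorem 1) the pair is NOT covered; where they converge
absolutely a.e. the pointwise sums agree with the continuity extension (dominated convergence along
`L²`-truncations), so this is a sub-class of the printed relation.
[cite: deBranges1986, Theorem 2, p. 9 l. 7–10] -/
def IsScatteringPair (χ : DirichletCharacter ℂ r) (F G : ℂ → ℂ) : Prop :=
  MemPInfty F ∧ MemPInfty G ∧
    ∀ᵐ z : ℂ, 0 < z.im →
      Summable (fun p : cosetPairs r => summand χ⁻¹ G z (p : ℤ × ℤ)) ∧
      Summable (fun p : cosetPairs r => summand χ F (-1 / ((r : ℂ) * z)) (p : ℤ × ℤ)) ∧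
      summation χ⁻¹ G z = summation χ F (-1 / ((r : ℂ) * z))

/-! ## Theorems 1–5 as named facts -/

/-- RH-FREE. **de Branges 1986, Theorem 1** (p. 7 l. 5–13), verbatim: *Assume that `χ` is a
nonprincipal even character modulo `r`. Then an isometric transformation exists of the space `𝒫(∞)`
into the space `𝒫_χ(r)` which takes `F(z)` into `½ Σ χ(D) F((Az+B)/(Cz+D))`, where summation is
over all pairs of relatively prime integers `C` and `D` such that `C` is divisible by `r`, `A` and `B`
being corresponding integers such that `AD − BC = 1`. The adjoint transformation of `𝒫_χ(r)` into
`𝒫(∞)` is a partial isometry which takes `F(z)` into `∫₀¹ F(z − t) dt`.* "The summation … is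
absolutely convergent almost everywhere under the hypothesis that `∫₀^∞ |F(iy)| y⁻² dy` is finite.
The transformation is otherwise defined by continuity" (p. 7 l. 14–19).
Lean rendering (on that dense class, for every fundamental region `Ω`): (i) a.e. absolute
convergence; (ii) the sum `G` lies in `𝒫_χ(r)` and `‖G‖_{𝒫_χ(r)} = ‖F‖_{𝒫(∞)}` (the isometry,
printed proof p. 8 l. 21–26); (iii) the adjoint identity `⟨G, H⟩_{𝒫_χ(r)} = ⟨F, ∫₀¹ H(· − t) dt⟩_{𝒫(∞)}`
for every `H ∈ 𝒫_χ(r)` (printed proof p. 8 l. 27–33). TODO(general form): the extension by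
continuity to all of `𝒫(∞)` and "partial isometry" are not restated. [cite: deBranges1986, Theorem 1, p. 7] -/
def deBranges1986_thm1 : Prop :=
  ∀ (r : ℕ) [NeZero r] (χ : DirichletCharacter ℂ r), χ ≠ 1 → χ.Even →
    ∀ F : ℂ → ℂ, MemPInfty F → IntegrableOn (fun y : ℝ => ‖F (y * I)‖ / y ^ 2) (Ioi 0) →
      (∀ᵐ z : ℂ, 0 < z.im → Summable (fun p : cosetPairs r => summand χ F z (p : ℤ × ℤ))) ∧
      (∀ Ω : Set ℂ, IsFundamentalRegion r Ω →
        MemPChar χ Ω (summation χ F) ∧ pCharNormSq Ω (summation χ F) = pInftyNormSq F) ∧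
      (∀ Ω : Set ℂ, IsFundamentalRegion r Ω → ∀ H : ℂ → ℂ, MemPChar χ Ω H →
        ∫ z in Ω, summation χ F z * conj (H z) / ((z.im : ℂ) ^ 2) =
          ∫ y in Ioi (0 : ℝ), F (y * I) * conj (∫ t in (0 : ℝ)..1, H (y * I - t)) / ((y : ℂ) ^ 2))

/-- RH-FREE. **de Branges 1986, Theorem 2** (p. 9 l. 7–14), verbatim: *Assume that `χ` is a
primitive even character modulo `r`, `r` not one. If `F(z)` belongs to `𝒫(∞)`, then a unique
element `G(z)` of `𝒫(∞)` exists such that `½ Σ χ̄(D) G((Az+B)/(Cz+D)) = ½ Σ χ(D) F((A−Brz)/(C−Drz))`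
[summation as in Theorem 1]. The identity
`ε(χ) r^{ix/2} (r/π)^{(1+ix)/2} Γ((1+ix)/2) ζ_χ̄(1+ix) ∫₀^∞ F(it) t^{(ix−3)/2} dt
 = (r/π)^{(1−ix)/2} Γ((1−ix)/2) ζ_χ(1−ix) ∫₀^∞ G(it) t^{(−ix−3)/2} dt`
holds for almost all real `x`.* (The Mellin integrals are mean-square transforms.)
Lean rendering: (i) uniqueness of `G` among scattering pairs (`IsScatteringPair`),
as equality a.e. on the imaginary axis; (ii) the identity for a.e. real `x`, for pairs whose two
Mellin integrands are absolutely integrable (explicit binders), the `Γ ζ`-products written as the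
tree's `dirichletXi` (`ε(χ) = rootNumber χ`, `χ̄ = χ⁻¹`). TODO(general form): existence of `G` for
every `F ∈ 𝒫(∞)` (it is the composite of the Theorem-1 isometries) is not restated.
[cite: deBranges1986, Theorem 2, p. 9] -/
def deBranges1986_thm2 : Prop :=
  ∀ (r : ℕ) [NeZero r] (χ : DirichletCharacter ℂ r), r ≠ 1 → χ.IsPrimitive → χ.Even →
    (∀ F G₁ G₂ : ℂ → ℂ, IsScatteringPair χ F G₁ → IsScatteringPair χ F G₂ →
      ∀ᵐ y : ℝ, 0 < y → G₁ (y * I) = G₂ (y * I)) ∧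
    (∀ F G : ℂ → ℂ, IsScatteringPair χ F G →
      IntegrableOn (fun t : ℝ => ‖F (t * I)‖ * t ^ (-(3 / 2 : ℝ))) (Ioi 0) →
      IntegrableOn (fun t : ℝ => ‖G (t * I)‖ * t ^ (-(3 / 2 : ℝ))) (Ioi 0) →
      ∀ᵐ x : ℝ,
        χ.rootNumber * (r : ℂ) ^ (I * x / 2) * dirichletXi χ⁻¹ (1 + I * x) *
            ∫ t in Ioi (0 : ℝ), F (t * I) * (t : ℂ) ^ ((I * x - 3) / 2) =
          dirichletXi χ (1 - I * x) *
            ∫ t in Ioi (0 : ℝ), G (t * I) * (t : ℂ) ^ ((-(I * x) - 3) / 2))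

/-- RH-FREE. **de Branges 1986, Theorem 3** (p. 10 l. 37 – p. 11 l. 8), verbatim: *Assume that `χ`
is a primitive even character modulo `r`, `r` not one. For positive numbers `t`, define
`k_χ(t) = Σ φ(n)χ(n) n⁻¹ (t − n²)^{-1/2}`, where summation is over the positive integers `n` such
that `n² < t`. Let `F(z)` and `G(z)` be elements of `𝒫(∞)` such that [the scattering relation].
Then `G(iy) = ∫₁^∞ F(i/(yrt)) y k_χ(t) dt`. The integral is interpreted as a limit in the mean
square sense of `∫₁^a`.*
Lean rendering: for scattering pairs (`IsScatteringPair`), under the explicit binder that the truncated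
integrands are integrable on `(1, a]` for a.e. `y`, the truncations converge to `G` in the
`𝒫(∞)`-norm: `∫₀^∞ |G(iy) − ∫₁^a F(i/(yrt)) y k_χ(t) dt|² y⁻² dy → 0` as `a → ∞`.
[cite: deBranges1986, Theorem 3, pp. 10–11] -/
def deBranges1986_thm3 : Prop :=
  ∀ (r : ℕ) [NeZero r] (χ : DirichletCharacter ℂ r), r ≠ 1 → χ.IsPrimitive → χ.Even →
    ∀ F G : ℂ → ℂ, IsScatteringPair χ F G →
      (∀ a : ℝ, 1 ≤ a → ∀ᵐ y : ℝ, 0 < y →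
        IntegrableOn (fun t : ℝ => F (I / ((y : ℂ) * r * t)) * y * kChar χ t) (Ioc 1 a)) →
      Tendsto (fun a : ℝ => ∫ y in Ioi (0 : ℝ),
          ‖G (y * I) - ∫ t in (1 : ℝ)..a, F (I / ((y : ℂ) * r * t)) * y * kChar χ t‖ ^ 2 / y ^ 2)
        atTop (𝓝 0)

/-- RH-FREE. **de Branges 1986, Theorem 4** (p. 11 l. 21 – p. 12 l. 7), verbatim: *An estimate of
Mellin transforms results. Assume that `χ` is a primitive even character modulo `r`, `r` not one.
Then `W_χ(z) = r^{-1/2} ∫₁^∞ k_χ(t) t^{(iz−1)/2} dt` is analytic and bounded by one in the upper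
half-plane. The identity `(r/π)^{(1−iz)/2} Γ((1−iz)/2) ζ_χ(1−iz) W_χ(z)
 = ε(χ) (r/π)^{(1+iz)/2} Γ((1+iz)/2) ζ_χ̄(1+iz)` holds in the upper half-plane.*
Lean rendering, with `E(z) := ξ(1−iz, χ) = EChar χ 1 z` and `ε(χ) ξ(1+iz, χ̄) = ε(χ) E♯(z)`:
(i) the binder-free content "`W_χ = ε(χ)E♯/E` is bounded by one on `Im z > 0`":
`‖ε(χ) ξ(1+iz, χ⁻¹)‖ ≤ ‖ξ(1−iz, χ)‖`; (ii) wherever the Mellin integrand is absolutely integrable on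
`(1, ∞)`, `‖W_χ(z)‖ ≤ 1` and `ξ(1−iz, χ) W_χ(z) = ε(χ) ξ(1+iz, χ⁻¹)`. (The strict inequality
`|W_χ(z)| < 1`, p. 12 l. 22–25, is recorded as `deBranges1986_isHermiteBiehler_EChar`.)
[cite: deBranges1986, Theorem 4, pp. 11–12] -/
def deBranges1986_thm4 : Prop :=
  ∀ (r : ℕ) [NeZero r] (χ : DirichletCharacter ℂ r), r ≠ 1 → χ.IsPrimitive → χ.Even →
    (∀ z : ℂ, 0 < z.im →
      ‖χ.rootNumber * dirichletXi χ⁻¹ (1 + I * z)‖ ≤ ‖dirichletXi χ (1 - I * z)‖) ∧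
    (∀ z : ℂ, 0 < z.im →
      IntegrableOn (fun t : ℝ => kChar χ t * (t : ℂ) ^ ((I * z - 1) / 2)) (Ioi 1) →
        ‖WChar χ z‖ ≤ 1 ∧
          dirichletXi χ (1 - I * z) * WChar χ z = χ.rootNumber * dirichletXi χ⁻¹ (1 + I * z))

/-- RH-FREE. **de Branges' structure functions of a primitive even character** ("Spectral theory",
p. 12 l. 22–29), verbatim: *Since `W_χ(z)` is not a constant of absolute value one, the strict
inequality `|W_χ(z)| < 1` holds in the upper half-plane. When `a ≥ 1`, define
`E_χ(a, z) = a^{−iz/2} (r/π)^{(1−iz)/2} Γ((1−iz)/2) ζ_χ(1−iz)`. Since `|E_χ(a, x − iy)| < |E_χ(a, x + iy)|`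
when `y > 0`, a space `𝓗(E_χ(a))` exists.* Typed as: `E_χ(a, ·)` is a Hermite–Biehler function
(tree predicate `IsHermiteBiehler`: entire, `‖E(z̄)‖ < ‖E(z)‖` on `Im z > 0`) for every primitive even
`χ` mod `r ≠ 1` and every `a ≥ 1`. This is the character analogue of the UNCONDITIONAL structure-
function property of `ξ(1 − iz)` (Lagarias 2005 Lemma 2.1 (1) at `h = 1/2`, tree
`lagarias2005_lemma_2_1`, PROVED); it is NOT a positivity condition and carries no RH content
(Conrey–Li GUARD R7, unconditional branch). [cite: deBranges1986, p. 12 l. 22–29] -/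
def deBranges1986_isHermiteBiehler_EChar : Prop :=
  ∀ (r : ℕ) [NeZero r] (χ : DirichletCharacter ℂ r), r ≠ 1 → χ.IsPrimitive → χ.Even →
    ∀ a : ℝ, 1 ≤ a → IsHermiteBiehler (EChar χ a)

/-- RH-FREE. **de Branges 1986, Theorem 5** (p. 12 l. 31 – p. 13 l. 12), verbatim: *Assume that `χ`
is a primitive even character modulo `r`, `r` not one, and that `a ≥ 1`. Let `F(z)` and `G(z)` be
elements of `𝒫(∞)`, which vanish for `y > a r^{-1/2}`, such that [the scattering relation]. Then a
corresponding element `H(z)` of `𝓗(E_χ̄(a))` exists such that the identities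
`H(z) = E_χ̄(1, z) ∫₀^{a r^{-1/2}} F(it) t^{(−iz−3)/2} dt` and
`H(−z) = ε̄(χ) E_χ(1, z) ∫₀^{a r^{-1/2}} G(it) t^{(−iz−3)/2} dt` hold when `y > 0`. The identities
`4π ‖F‖²_{𝒫(∞)} = ‖H‖²_{𝓗(E_χ̄(a))} = 4π ‖G‖²_{𝒫(∞)}` are satisfied. Every element of `𝓗(E_χ̄(a))`
is equal to such a function `H(z)` for unique such elements `F(z)` and `G(z)` of `𝒫(∞)`.*
Lean rendering: for scattering pairs (`IsScatteringPair`) vanishing above height `a r^{-1/2}`, existence of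
`H` in `𝓗(E_{χ⁻¹}(a))` — de Branges' membership p. 3 l. 17–21: entire, `∫ |H/E|² < ∞`,
`|H(z)|² ≤ ‖H‖² K(z,z)` (`HasKernelBound`) — with the two identities on `Im z > 0` (the integrals
converge absolutely there, `|t^{(−iz−3)/2}| = t^{(y−3)/2}` against `F(it) ∈ L²(t⁻²dt)`) and the norm
identities (`ε̄(χ) = conj (rootNumber χ)`). TODO(general form): "every element of `𝓗(E_χ̄(a))` is
such an `H`" (surjectivity onto pairs outside the class `IsScatteringPair`) is not restated.
[cite: deBranges1986, Theorem 5, pp. 12–13] -/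
def deBranges1986_thm5 : Prop :=
  ∀ (r : ℕ) [NeZero r] (χ : DirichletCharacter ℂ r), r ≠ 1 → χ.IsPrimitive → χ.Even →
    ∀ a : ℝ, 1 ≤ a → ∀ F G : ℂ → ℂ, IsScatteringPair χ F G →
      (∀ z : ℂ, a * (r : ℝ) ^ (-(1 / 2 : ℝ)) < z.im → F z = 0) →
      (∀ z : ℂ, a * (r : ℝ) ^ (-(1 / 2 : ℝ)) < z.im → G z = 0) →
        ∃ H : ℂ → ℂ,
          (Differentiable ℂ H ∧ Integrable (fun x : ℝ => ‖H x / EChar χ⁻¹ a x‖ ^ 2) ∧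
            HasKernelBound (EChar χ⁻¹ a) H) ∧
          (∀ z : ℂ, 0 < z.im →
            H z = EChar χ⁻¹ 1 z *
              ∫ t in Ioc (0 : ℝ) (a * (r : ℝ) ^ (-(1 / 2 : ℝ))),
                F (t * I) * (t : ℂ) ^ ((-(I * z) - 3) / 2)) ∧
          (∀ z : ℂ, 0 < z.im →
            H (-z) = conj χ.rootNumber * EChar χ 1 z *
              ∫ t in Ioc (0 : ℝ) (a * (r : ℝ) ^ (-(1 / 2 : ℝ))),
                G (t * I) * (t : ℂ) ^ ((-(I * z) - 3) / 2)) ∧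
          4 * π * pInftyNormSq F = deBrangesNormSq (EChar χ⁻¹ a) H ∧
          deBrangesNormSq (EChar χ⁻¹ a) H = 4 * π * pInftyNormSq G

end DeBranges1986

end Literature.Analysis.DeBrangesSpaces
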